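import Mathlib
import Summits.NavierStokesRegularity.NavierStokesRegularity.Theorems.EulerZoomLiouvillePowerGaugeEulerLiouvilleNeedleWaitingTime
import HarnessLib.Audit

/-!
# Crux E `EulerZoomLiouville.PowerGaugeEulerLiouville` — the needle portrait: THE WAITING-TIME EXPONENT
# (ROUND-38 (T_pow)): with STRONG thin fast exits `C R⁴ e^{−βR^e}`, a residence clock of strength `c′R^e`,
# `6γc′ < β`, kills the `C²` needle

Route №10 `EulerZoomLiouville` (NavierStokesRegularity), crux E = stmt-NavierStokesRegularity-19832,
registered residue `stub_selfSimilarC2Needle`; memo ROUND-38 of the cell `ns-regularity-ideate` (text custody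
nsreg-p2 g33, signature sheet `r38/Sketch38.lean`: `GeneralThinFastExitsStrong` (K″), `ResidenceClock`,
`NeedleDeadOfPowerClock`).  Sequel of `…NeedleWaitingTime` (the waiting-time law and the log-clock threshold).

* `exit_arith_powerClock` — at the clock `S = c′R^e` the exit bound of the feeding law against exits of size
  `C R⁴ e^{−βR^e}` is `≤ 8√C/(3γκδ²R)`, `δ = β/2 − 3γc′ > 0` (`x²/2 ≤ eˣ`; `R^e ≥ R` for `e ≥ 1`, `R ≥ 1`);
* **`curl_eq_zero_of_powerClock_of_strongThinExits`** — `U ∈ C²` divergence-free; for every `R ≥ 1` thin-exit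
  data (good squared radii `G ⊆ [R²,4R²]`, `|G| ≥ κR²`, tube `N ⊆ B̄_{2R}` catching the strictly γ-fast points of the
  good spheres) of size `|N|·∫_N‖U‖² ≤ C R⁴ e^{−βR^e}`; a RESIDENCE CLOCK of strength `c′R^e` with `6γc′ < β`
  (around every vortical point a ball at most half of whose labels stay in `‖·‖ ≤ 2R` during backward similarity
  time `c′R^e`, for all large `R`, every cut-off copy of `U`) ⇒ `curl U ≡ 0`.  With ROUND-38 (K″)
  (`e = 2 + ρ`, `β = c₀γ²/(c_A + c_E + 1)` from the band law t39b) this is the WAITING-TIME EXPONENT `2 + ρ`: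
  any symmetry-free clock `o(R^{2+ρ})` kills THE ONE STATEMENT's `C²` needle; the axisymmetric swirl-free Casimir
  gives `O(log R)` (`…NeedleAxisymNoSwirlMember`); in general none is known (ROUND-38: Kelvin–Cauchy weights are
  balanced identities) — a threshold theorem, not a kill.

NOT NS, not E; 19832 OPEN.  References: Constantin–Ignatova–Vicol arXiv:2602.17570 §3.4–§3.5
[ConstantinIgnatovaVicol2026Putative]; (`x²/2 ≤ eˣ`, Cauchy–Schwarz) [folklore].
-/

noncomputable section

-- the summit and its single problem share the name `NavierStokesRegularity` (D-0017 nested layout)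
set_option linter.dupNamespace false

open Set Filter Topology Metric Function MeasureTheory InnerProductSpace
open scoped RealInnerProductSpace NNReal ENNReal

namespace Summit.NavierStokesRegularity.NavierStokesRegularity.Theorems.PowerGaugeEulerLiouville.NeedleRace

open Literature.Analysis Literature.Analysis.FluidPDE
open Summit.NavierStokesRegularity.NavierStokesRegularity.Theorems.PowerGaugeEulerLiouville

variable {γ : ℝ} {U : EuclideanSpace ℝ (Fin 3) → EuclideanSpace ℝ (Fin 3)}

/-! ### The threshold with the band-law exponent: a residence clock of strength `o(R^{2+ρ})` -/

/-- **Exit arithmetic at a power clock**: with `S = c′R^e` (`c′ ≥ 0`, `e ≥ 1`, `R ≥ 1`) and STRONG thin exits of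
size `C R⁴ e^{−βR^e}`, `δ = β/2 − 3γc′ > 0`:
`(4/(κR)) · ((e^{3γS} − 1)/(3γ)) · √(C R⁴ e^{−βR^e}) ≤ 8√C/(3γκδ²R)` (`x²/2 ≤ eˣ`). [folklore] -/
theorem exit_arith_powerClock {γ κ c' β C e R : ℝ} (hγ : 0 < γ) (hκ : 0 < κ)
    (he : 1 ≤ e) (hR : 1 ≤ R) (hδ : 0 < β / 2 - 3 * γ * c') :
    4 / (κ * R) * ((Real.exp (3 * γ * (c' * R ^ e)) - 1) / (3 * γ)) *
        Real.sqrt (C * R ^ (4 : ℝ) * Real.exp (-(β * R ^ e))) ≤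
      8 * Real.sqrt C / (3 * γ * κ * (β / 2 - 3 * γ * c') ^ 2 * R) := by
  set δ : ℝ := β / 2 - 3 * γ * c' with hδdef
  have hR0 : 0 < R := by linarith
  have h3γ : 0 < 3 * γ := by positivity
  set X : ℝ := R ^ e with hX
  have hXR : R ≤ X := by
    rw [hX]
    calc R = R ^ (1 : ℝ) := (Real.rpow_one R).symm
      _ ≤ R ^ e := Real.rpow_le_rpow_of_exponent_le hR he
  have hX0 : 0 ≤ X := hR0.le.trans hXR
  -- `√(exp x) = exp (x/2)`
  have sqrt_exp : ∀ x : ℝ, Real.sqrt (Real.exp x) = Real.exp (x / 2) := fun x => by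
    rw [show Real.exp x = Real.exp (x / 2) ^ 2 by rw [sq, ← Real.exp_add]; congr 1; ring]
    exact Real.sqrt_sq (Real.exp_pos _).le
  -- the clock factor
  have hcS : (Real.exp (3 * γ * (c' * X)) - 1) / (3 * γ) ≤ Real.exp (3 * γ * c' * X) / (3 * γ) := by
    rw [show 3 * γ * (c' * X) = 3 * γ * c' * X by ring]
    exact div_le_div_of_nonneg_right (by linarith) h3γ.le
  -- the exit size
  have hR4 : R ^ (4 : ℝ) = (R ^ 2) ^ 2 := by
    rw [show (4 : ℝ) = ((4 : ℕ) : ℝ) by norm_num, Real.rpow_natCast]; ring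
  have hsqrt : Real.sqrt (C * R ^ (4 : ℝ) * Real.exp (-(β * X))) =
      Real.sqrt C * R ^ 2 * Real.exp (-(β * X) / 2) := by
    rw [Real.sqrt_mul' _ (Real.exp_pos _).le, Real.sqrt_mul' _ (by positivity), hR4,
      Real.sqrt_sq (by positivity), sqrt_exp]
  -- the product of the two exponentials
  have hexp : Real.exp (3 * γ * c' * X) * Real.exp (-(β * X) / 2) = Real.exp (-(δ * X)) := by
    rw [← Real.exp_add]; congr 1; rw [hδdef]; ring
  -- `R e^{−δX} ≤ R e^{−δR} ≤ 2/(δ²R)`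
  have htail : R * Real.exp (-(δ * X)) ≤ 2 / (δ ^ 2 * R) := by
    have h1 : Real.exp (-(δ * X)) ≤ Real.exp (-(δ * R)) :=
      Real.exp_le_exp.2 (by nlinarith [mul_le_mul_of_nonneg_left hXR hδ.le])
    have h2 : (δ * R) ^ 2 / 2 ≤ Real.exp (δ * R) := by
      have := Real.quadratic_le_exp_of_nonneg (by positivity : 0 ≤ δ * R)
      nlinarith [sq_nonneg (δ * R), this, mul_pos hδ hR0]
    have h3 : Real.exp (-(δ * R)) ≤ 2 / (δ * R) ^ 2 := by
      rw [Real.exp_neg, inv_eq_one_div, div_le_div_iff₀ (Real.exp_pos _) (by positivity)]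
      nlinarith
    calc R * Real.exp (-(δ * X)) ≤ R * Real.exp (-(δ * R)) := mul_le_mul_of_nonneg_left h1 hR0.le
      _ ≤ R * (2 / (δ * R) ^ 2) := mul_le_mul_of_nonneg_left h3 hR0.le
      _ = 2 / (δ ^ 2 * R) := by field_simp
  have hκR : 0 < 4 / (κ * R) := by positivity
  calc 4 / (κ * R) * ((Real.exp (3 * γ * (c' * X)) - 1) / (3 * γ)) *
        Real.sqrt (C * R ^ (4 : ℝ) * Real.exp (-(β * X)))
      ≤ 4 / (κ * R) * (Real.exp (3 * γ * c' * X) / (3 * γ)) *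
          Real.sqrt (C * R ^ (4 : ℝ) * Real.exp (-(β * X))) :=
        mul_le_mul_of_nonneg_right (mul_le_mul_of_nonneg_left hcS hκR.le) (Real.sqrt_nonneg _)
    _ = 4 * Real.sqrt C / (3 * γ * κ) * (R * (Real.exp (3 * γ * c' * X) * Real.exp (-(β * X) / 2))) := by
        rw [hsqrt]; field_simp
    _ = 4 * Real.sqrt C / (3 * γ * κ) * (R * Real.exp (-(δ * X))) := by rw [hexp]
    _ ≤ 4 * Real.sqrt C / (3 * γ * κ) * (2 / (δ ^ 2 * R)) :=
        mul_le_mul_of_nonneg_left htail (by positivity)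
    _ = 8 * Real.sqrt C / (3 * γ * κ * δ ^ 2 * R) := by
        field_simp
        ring

/-- **THE THRESHOLD (T_pow): A RESIDENCE CLOCK OF STRENGTH `c′R^e` WITH `6γc′ < β` KILLS THE NEEDLE, given STRONG thin
fast exits of size `C R⁴ e^{−βR^e}`** (the band-law exponent of ROUND-38 (K″): `e = 2 + ρ`, `β ≍ γ²/(c_A+c_E+1)`).
`U ∈ C²` divergence-free; for every `R ≥ 1` thin-exit data `(G, N)` (good squared radii, |G| ≥ κR², tube catching the
strictly γ-fast points) with `|N|·∫_N‖U‖² ≤ C R⁴ e^{−βR^e}`; a residence clock of strength `c′R^e`: around every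
vortical point a ball at most half of whose labels stay in `‖·‖ ≤ 2R` during backward time `c′R^e`, for all large
`R` and every cut-off copy.  Then `curl U ≡ 0`.  Any clock `o(R^e)` meets the hypothesis. [folklore; ConstantinIgnatovaVicol2026Putative §3.5] -/
theorem curl_eq_zero_of_powerClock_of_strongThinExits (hU2 : ContDiff ℝ 2 U) (hdivU : VectorCalculus.IsDivFree U)
    (hγ : 0 < γ) {κ : ℝ} (hκ : 0 < κ) {e β C : ℝ} (he : 1 ≤ e) (hC : 0 ≤ C)
    (hthinS : ∀ R : ℝ, 1 ≤ R →
      ∃ (G : Set ℝ) (N : Set (EuclideanSpace ℝ (Fin 3))),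
        MeasurableSet G ∧ G ⊆ Icc (R ^ 2) ((2 * R) ^ 2) ∧ κ * R ^ 2 ≤ (volume G).toReal ∧
        MeasurableSet N ∧ N ⊆ closedBall (0 : EuclideanSpace ℝ (Fin 3)) (2 * R) ∧
        (∀ z : EuclideanSpace ℝ (Fin 3), ‖z‖ ^ 2 ∈ G → ⟪U z, z⟫ + γ * ‖z‖ ^ 2 < 0 → z ∈ N) ∧
        volume N * ∫⁻ z in N, ENNReal.ofReal (‖U z‖ ^ 2) ≤
          ENNReal.ofReal (C * R ^ (4 : ℝ) * Real.exp (-(β * R ^ e))))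
    {c' : ℝ} (hc' : 0 ≤ c') (hβc : 6 * γ * c' < β)
    (hclock : ∀ x₀ : EuclideanSpace ℝ (Fin 3), curl U x₀ ≠ 0 → ∃ r : ℝ, 0 < r ∧ ∃ R₀ : ℝ, ∀ R : ℝ, R₀ ≤ R →
      ∀ (V : EuclideanSpace ℝ (Fin 3) → EuclideanSpace ℝ (Fin 3)) (K Rbig : ℝ), ContDiff ℝ 2 V →
        (∀ y, ‖fderiv ℝ V y‖ ≤ K) → 2 * R < Rbig →
        (∀ w ∈ ball (0 : EuclideanSpace ℝ (Fin 3)) Rbig, V w = U w) →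
        (volume (ball x₀ r ∩ {y | ∀ σ ∈ Icc 0 (c' * R ^ e),
          ‖ODE.evolutionMap (fun _ : ℝ => selfSimilarTransport γ 0 V) 0 (-σ) y‖ ≤ 2 * R})).toReal ≤
          (volume (ball x₀ r)).toReal / 2)
    (x₀ : EuclideanSpace ℝ (Fin 3)) : curl U x₀ = 0 := by
  by_contra hx₀
  have hδ : 0 < β / 2 - 3 * γ * c' := by linarith
  set δ : ℝ := β / 2 - 3 * γ * c' with hδdef
  -- ### the blob and the clock
  obtain ⟨r, hr, R₁, hR₁⟩ := hclock x₀ hx₀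
  set B₀ : Set (EuclideanSpace ℝ (Fin 3)) := ball x₀ r with hB₀
  have hB₀m : MeasurableSet B₀ := measurableSet_ball
  have hv₀pos : 0 < volume B₀ := measure_ball_pos volume x₀ hr
  have hv₀top : volume B₀ < ⊤ := measure_ball_lt_top
  set v₀ : ℝ := (volume B₀).toReal with hv₀
  have hv₀0 : 0 < v₀ := ENNReal.toReal_pos hv₀pos.ne' hv₀top.ne
  -- ### the radius
  set A : ℝ := 8 * Real.sqrt C / (3 * γ * κ * δ ^ 2) with hA
  have hA0 : 0 ≤ A := by rw [hA]; positivity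
  set R : ℝ := max (max R₁ 1) (max (‖x₀‖ + r) (2 * A / v₀ + 1)) with hRdef
  have hRR₁ : R₁ ≤ R := (le_max_left _ _).trans (le_max_left _ _)
  have hR1 : 1 ≤ R := (le_max_right _ _).trans (le_max_left _ _)
  have hRx : ‖x₀‖ + r ≤ R := (le_max_left _ _).trans (le_max_right _ _)
  have hRv : 2 * A / v₀ + 1 ≤ R := (le_max_right _ _).trans (le_max_right _ _)
  have hR0 : 0 < R := by linarith
  obtain ⟨G, N, hGm, hG, hGvol, hNm, hNsub, hLemK, hNJ⟩ := hthinS R hR1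
  set S : ℝ := c' * R ^ e with hSdef
  have hS : 0 ≤ S := mul_nonneg hc' (Real.rpow_nonneg hR0.le _)
  -- ### the cut-off field
  set Rbig : ℝ := 2 * R + 1 with hRbigdef
  obtain ⟨V, hV2, -, -, ⟨K, hK⟩, hVU⟩ := Loc.exists_cutoff_local hU2 (R := Rbig) (by positivity)
  have hRbig : 2 * R < Rbig := by rw [hRbigdef]; linarith
  have hdiv : ∀ z : EuclideanSpace ℝ (Fin 3), ‖z‖ ≤ 2 * R → VectorCalculus.divergence V z = 0 := by
    intro z hz
    have hzball : z ∈ ball (0 : EuclideanSpace ℝ (Fin 3)) Rbig := mem_ball_zero_iff.2 (by linarith)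
    have hev : V =ᶠ[𝓝 z] U := by
      filter_upwards [isOpen_ball.mem_nhds hzball] with w hw using hVU w hw
    unfold VectorCalculus.divergence
    rw [hev.fderiv_eq]
    exact hdivU z
  set Φ := ODE.evolutionMap (fun _ : ℝ => selfSimilarTransport γ 0 V) 0 with hΦ
  -- ### the blob sits in `B̄_R`
  have hB₀R : B₀ ⊆ closedBall (0 : EuclideanSpace ℝ (Fin 3)) R := by
    intro y hy
    rw [hB₀, mem_ball] at hy
    rw [mem_closedBall_zero_iff]
    have h1 : ‖y‖ ≤ ‖y - x₀‖ + ‖x₀‖ := norm_le_norm_sub_add y x₀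
    rw [← dist_eq_norm] at h1
    linarith
  -- ### the two halves
  set Stay : Set (EuclideanSpace ℝ (Fin 3)) := {y | ∀ σ ∈ Icc 0 S, ‖Φ (-σ) y‖ ≤ 2 * R} with hStay
  have hStaym : MeasurableSet Stay := (isClosed_backwardStay (γ := γ) hV2 hK S (2 * R)).measurableSet
  have h1 : (volume (B₀ ∩ Stay)).toReal ≤ v₀ / 2 := hR₁ R hRR₁ V K Rbig hV2 hK hRbig hVU
  -- exit half: feeding law + bookkeeping + the power-clock arithmetic
  have h2raw := ofReal_mul_volume_exit_le (γ := γ) (U := U) hV2 hK hγ hR0 hRbig hVU hdiv hS hB₀m hB₀R hGm hG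
    hNm hNsub hLemK
  set cS : ℝ := (Real.exp (3 * γ * S) - 1) / (3 * γ) with hcS
  have hcS0 : 0 ≤ cS := by
    rw [hcS]
    apply div_nonneg _ (by positivity)
    have : 1 ≤ Real.exp (3 * γ * S) := Real.one_le_exp (by positivity)
    linarith
  set g : ℝ := (volume G).toReal / (4 * R) with hg
  have hgκ : κ * R / 4 ≤ g := by
    rw [hg, le_div_iff₀ (by positivity)]
    nlinarith [hGvol, hR0, hκ]
  have hgpos : 0 < g := lt_of_lt_of_le (by positivity) hgκ
  have hε0 : 0 ≤ C * R ^ (4 : ℝ) * Real.exp (-(β * R ^ e)) := by positivity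
  have h3 := toReal_le_of_feeding (N := N) hgpos hcS0 hε0 h2raw hNJ
  have h2 : (volume (B₀ \ Stay)).toReal ≤ A / R := by
    refine h3.trans ?_
    have h4 : cS * Real.sqrt (C * R ^ (4 : ℝ) * Real.exp (-(β * R ^ e))) / g ≤
        cS * Real.sqrt (C * R ^ (4 : ℝ) * Real.exp (-(β * R ^ e))) / (κ * R / 4) :=
      div_le_div_of_nonneg_left (by positivity) (by positivity) hgκ
    refine h4.trans ?_
    have h5 : cS * Real.sqrt (C * R ^ (4 : ℝ) * Real.exp (-(β * R ^ e))) / (κ * R / 4) =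
        4 / (κ * R) * cS * Real.sqrt (C * R ^ (4 : ℝ) * Real.exp (-(β * R ^ e))) := by
      field_simp
    rw [h5, hcS, hSdef]
    have h6 := exit_arith_powerClock (C := C) hγ hκ he hR1 hδ
    rw [← hδdef] at h6
    refine h6.trans (le_of_eq ?_)
    rw [hA]
    field_simp
  -- `A/R < v₀/2`
  have h3' : A / R < v₀ / 2 := by
    rw [div_lt_iff₀ hR0]
    have : 2 * A / v₀ < R := by linarith
    rw [div_lt_iff₀ hv₀0] at this
    linarith
  -- ### the sum
  have hsplit : volume (B₀ ∩ Stay) + volume (B₀ \ Stay) = volume B₀ := measure_inter_add_sdiff B₀ hStaym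
  have hfin1 : volume (B₀ ∩ Stay) ≠ ⊤ := ((measure_mono inter_subset_left).trans_lt hv₀top).ne
  have hfin2 : volume (B₀ \ Stay) ≠ ⊤ := ((measure_mono Set.sdiff_subset).trans_lt hv₀top).ne
  have hsum : v₀ = (volume (B₀ ∩ Stay)).toReal + (volume (B₀ \ Stay)).toReal := by
    rw [hv₀, ← hsplit, ENNReal.toReal_add hfin1 hfin2]
  linarith

end Summit.NavierStokesRegularity.NavierStokesRegularity.Theorems.PowerGaugeEulerLiouville.NeedleRace

end
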